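import Summits.QuantumFields.YangMills.Theorems.BalabanUVNodesN18CombStepC0Sum
import HarnessLib

/-!
# N18 (β)-transport letters: THE DECOMPOSITION OF THE CANCELLED C⁰ COMBINATION — `A′_A − i∇l = (η∕ξ)·L·Q(Ad(v₀)A′) + E`, `‖E‖ ≤ R∕ξ + (η∕ξ)·69ℓ²ta`

[DAGN18W3-G5 INTENT-4, file (4c)] — count-neutral helper toward K3⁸ `stmt-QuantumFields-27366` (K3⁷ `stmt-QuantumFields-20544` aside; NOT claimed, NOT closed).
YM mass gap (Clay) NOT proved by any of this; R4 closes the conditional finite-𝕋⁴ rung `BalabanLadder.UV` only.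

WHY.  (2b) p631588 bounds the cancelled C⁰ combination `W(c) = (iξ)⁻¹log(Ū(𝐔)(c)Ū(U)(c)⁻¹) + (η∕ξ)(Ū(U)(c)·m(c₊)·Ū(U)(c)⁻¹ − m(c₋))` by `(η∕ξ)La + R∕ξ + …` in ONE
piece.  The C¹ letter needs its STRUCTURE: `W(c) = (η∕ξ)·L·(QY)(c) + E(c)`, `Y = Ad(v₀)A′`, `v₀ = axialT U (emb c₋)`, `Q = LatticeFieldCalculus.bondAvg` (the straight block
mean of [Balaban1984PropagatorsI] (1.11)), with the remainder `E(c)` SECOND ORDER: `‖E(c)‖ ≤ R∕ξ + (η∕ξ)·69ℓ²·t·a` — p623404's linearisation letter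
`(iξ)⁻¹log(Ū(S)Ū(U₀)⁻¹) = (η∕ξ)Q₁A + O(R∕ξ)` (UST Prop. 3 at the flat background) on the cut-off gauged triple of p630236, the tree identity
`Q₁ = L·Q − (λ̄(c₊) − λ̄(c₋))` (`BlockAveragingEMLLinearised.linAvg_eq_bondAvg_sub_grad_combMean`), `λ̄_{v₀}(c₋) = m(c₋)` verbatim, and the base change of (2a)∕(2b).

WHAT (ns `YMDAG.N18.TransportOfRecord`): ★ `norm_transported_comb_sub_main_le` — under (2b)'s two-block-local hypotheses at `c`:
`‖W(c) − (η∕ξ)·L·Q(Ad(axialT U (emb c₋))A′)(c)‖ ≤ R∕ξ + (η∕ξ)·69ℓ²·t·a`.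

0 `def`, 0 `sorry`.  References: T. Bałaban, CMP **98** (1985) [Balaban1985Averaging] ((62)–(63) p.28, Prop. 3 (122)–(126) p.36, pp.24–25); CMP **95** (1984)
[Balaban1984PropagatorsI] ((1.11) p.19); CMP **109** (1987) [Balaban1987RG1] ((0.4) p.253, (1.10)–(1.13) p.262).
-/

noncomputable section

open scoped BigOperators Matrix.Norms.L2Operator
open NormedSpace

namespace YMDAG.N18.TransportOfRecord

open Complex (I)
open Literature.MathematicalPhysics.QuantumFieldTheory.Balaban1983to89
open Literature.MathematicalPhysics.QuantumFieldTheory.Balaban1983to89.T4Continuum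
open Literature.MathematicalPhysics.QuantumFieldTheory.Balaban1983to89.BlockAveraging
open Literature.MathematicalPhysics.QuantumFieldTheory.Balaban1983to89.BlockAveragingEMLLinearised (linAvg combMean linAvg_eq_bondAvg_sub_grad_combMean)
open Literature.MathematicalPhysics.QuantumFieldTheory.Balaban1983to89.LatticeFieldCalculus (bondAvg)
open Literature.MathematicalPhysics.QuantumFieldTheory.Balaban1983to89.B12RegularSpaces111 (expI gaugeU adJ plaq plaq_eq)
open Literature.MathematicalPhysics.QuantumFieldTheory.Balaban1983to89.B12RegularSpaces111Mono (expI_zero)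
open Literature.MathematicalPhysics.QuantumFieldTheory.Balaban1983to89.MatrixLog (mlog)
open Literature.MathematicalPhysics.QuantumFieldTheory.Balaban1983to89.B7Prop1Explicit (U1 mem_U1)
open Literature.MathematicalPhysics.QuantumFieldTheory.Balaban1983to89.B10Eq27TorusAxialLog (axialT axialT_self)
open Literature.MathematicalPhysics.QuantumFieldTheory.Balaban1983to89.T4TermwiseBCH (norm_units_conj_le)
open Literature.MathematicalPhysics.QuantumFieldTheory.Balaban1983to89.Node00.W1 (avgUnits)
open Summit.QuantumFields.YangMills.Theorems.Prop8Chart (emlAvgU_congr₂ norm_emlAvgU_sub_one_sub_linAvg_le)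
open YMDAG.N18.AvgPotential (combMean_congr_block bondAvg_congr₂)

variable {P : Params} {j : ℕ}

section Decomposition

variable {n : Type*} [Fintype n] [DecidableEq n] [Nonempty n]

/-- ★ **THE DECOMPOSITION OF THE CANCELLED C⁰ COMBINATION.**  Under (2b)'s two-block-local hypotheses at the coarse bond `c` (`j + 2 ≤ m + K`; factorisation
`𝐔 = (exp iηA′)·U`, `|A′| ≤ a`, `U ∈ U1`, plaquettes `≤ α`, `((d+2)L∕2)α ≤ t`, `ηa ≤ 1∕2`, `136ℓ((2ηa + t + 2ηa·t) + t) ≤ 1`), with `v₀ = axialT U (emb c₋)`, `Y = Ad(v₀)A′`,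
`m(z) = λ̄_{Ad(axialT U (emb z))A′}(z)`, `U_A = Ū(U)`:
`‖[(iξ)⁻¹log(Ū(𝐔)(c)U_A(c)⁻¹) + (η∕ξ)(U_A(c)·m(c₊)·U_A(c)⁻¹ − m(c₋))] − (η∕ξ)·L·(QY)(c)‖ ≤ R∕ξ + (η∕ξ)·69ℓ²·t·a`, `R` = p623404's second-order remainder.
[cite: Balaban1985Averaging, Prop. 3 (122)-(126) p.36, (62)-(63) p.28, pp.24-25; Balaban1984PropagatorsI, (1.11) p.19; Balaban1987RG1, (0.4) p.253, (1.10)-(1.13) p.262] -/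
theorem norm_transported_comb_sub_main_le (hj : j + 1 ≤ P.m + P.K) (hj2 : j + 2 ≤ P.m + P.K) (c : PBond P (j + 1))
    {Uc U : GaugeField P j (Matrix n n ℂ)ˣ} {A : PBond P j → Matrix n n ℂ} {η ξ a α t : ℝ} (hη : 0 ≤ η) (hξ : 0 < ξ) (ha0 : 0 ≤ a) (hα : 0 ≤ α)
    (hf : ∀ b : PBond P j, (blockOf b.src = c.src ∨ blockOf b.src = c.tgt) → (blockOf b.tgt = c.src ∨ blockOf b.tgt = c.tgt) →
      Uc b = expI η (A b) * U b)
    (hA : ∀ b : PBond P j, (blockOf b.src = c.src ∨ blockOf b.src = c.tgt) → (blockOf b.tgt = c.src ∨ blockOf b.tgt = c.tgt) → ‖A b‖ ≤ a)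
    (hηa : η * a ≤ 1 / 2)
    (hU1 : ∀ b : PBond P j, (blockOf b.src = c.src ∨ blockOf b.src = c.tgt) → (blockOf b.tgt = c.src ∨ blockOf b.tgt = c.tgt) →
      U b ∈ U1 (Matrix n n ℂ))
    (hplaq : ∀ p : Plaq P j, (blockOf p.src = c.src ∨ blockOf p.src = c.tgt) →
      (blockOf (p.src.shift p.μ) = c.src ∨ blockOf (p.src.shift p.μ) = c.tgt) →
      (blockOf (p.src.shift p.ν) = c.src ∨ blockOf (p.src.shift p.ν) = c.tgt) →
      (blockOf ((p.src.shift p.μ).shift p.ν) = c.src ∨ blockOf ((p.src.shift p.μ).shift p.ν) = c.tgt) →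
      ‖((plaq U p : (Matrix n n ℂ)ˣ) : Matrix n n ℂ) - 1‖ ≤ α)
    (hRt : ((((P.d + 2) * P.L : ℕ) : ℝ) / 2) * α ≤ t)
    (hℓ : 136 * (((P.d + 2) * P.L : ℕ) : ℝ) * ((2 * (η * a) + t + 2 * (η * a) * t) + t) ≤ 1) :
    ‖((I * (ξ : ℂ))⁻¹ • mlog (((avgUnits Uc c : (Matrix n n ℂ)ˣ) : Matrix n n ℂ) * (((avgUnits U c)⁻¹ : (Matrix n n ℂ)ˣ) : Matrix n n ℂ)) +
        ((η / ξ : ℝ) : ℂ) • (((avgUnits U c : (Matrix n n ℂ)ˣ) : Matrix n n ℂ) * combMean (adJ (axialT U (emb c.tgt)) A) c.tgt *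
            (((avgUnits U c)⁻¹ : (Matrix n n ℂ)ˣ) : Matrix n n ℂ) - combMean (adJ (axialT U (emb c.src)) A) c.src)) -
        ((η / ξ : ℝ) : ℂ) • (((P.L : ℕ) : ℂ) • bondAvg (adJ (axialT U (emb c.src)) A) c)‖ ≤
      (4 * (34 * (((P.d + 2) * P.L : ℕ) : ℝ) * ((2 * (η * a) + t + 2 * (η * a) * t) + t)) ^ 2 +
        578 * (((P.d + 2) * P.L : ℕ) : ℝ) ^ 2 * ((2 * (η * a) + t + 2 * (η * a) * t) + t) * t +
        660 * (((P.d + 2) * P.L : ℕ) : ℝ) ^ 2 * ((2 * (η * a) + t + 2 * (η * a) * t) ^ 2 + t ^ 2) +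
        3 * (((P.d + 2) * P.L : ℕ) : ℝ) * (2 * (η * a) * t) + 3 * (((P.d + 2) * P.L : ℕ) : ℝ) * (η * a) ^ 2) / ξ +
      η / ξ * (69 * (((P.d + 2) * P.L : ℕ) : ℝ) ^ 2 * t * a) := by
  classical
  have ht0 : 0 ≤ t := le_trans (by positivity) hRt
  -- the two-block predicate (blocks) and the box predicate (relative positions); the former implies the latter
  let χ : PBond P j → Prop := fun b => (blockOf b.src = c.src ∨ blockOf b.src = c.tgt) ∧ (blockOf b.tgt = c.src ∨ blockOf b.tgt = c.tgt)
  -- the cut-off fields (before gauging): globally `U1`, factorised everywhere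
  let U' : GaugeField P j (Matrix n n ℂ)ˣ := fun b => if χ b then U b else 1
  let Uc' : GaugeField P j (Matrix n n ℂ)ˣ := fun b => if χ b then Uc b else 1
  let A' : PBond P j → Matrix n n ℂ := fun b => if χ b then A b else 0
  have hU'U : ∀ b : PBond P j, (blockOf b.src = c.src ∨ blockOf b.src = c.tgt) → (blockOf b.tgt = c.src ∨ blockOf b.tgt = c.tgt) → U' b = U b :=
    fun b h1 h2 => by simp only [U', χ, if_pos (And.intro h1 h2)]
  have hUU' : ∀ b : PBond P j, (blockOf b.src = c.src ∨ blockOf b.src = c.tgt) → (blockOf b.tgt = c.src ∨ blockOf b.tgt = c.tgt) → U b = U' b :=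
    fun b h1 h2 => (hU'U b h1 h2).symm
  have hUcUc' : ∀ b : PBond P j, (blockOf b.src = c.src ∨ blockOf b.src = c.tgt) → (blockOf b.tgt = c.src ∨ blockOf b.tgt = c.tgt) → Uc b = Uc' b :=
    fun b h1 h2 => by simp only [Uc', χ, if_pos (And.intro h1 h2)]
  have hU'1 : ∀ b, U' b ∈ U1 (Matrix n n ℂ) := fun b => by
    by_cases hb : χ b
    · simp only [U', if_pos hb]; exact hU1 b hb.1 hb.2
    · simp only [U', if_neg hb]; exact (U1 _).one_mem
  have hf' : ∀ b, Uc' b = expI η (A' b) * U' b := fun b => by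
    by_cases hb : χ b
    · simp only [Uc', U', A', if_pos hb]; exact hf b hb.1 hb.2
    · simp only [Uc', U', A', if_neg hb, expI_zero, one_mul]
  have hA' : ∀ b, ‖A' b‖ ≤ a := fun b => by
    by_cases hb : χ b
    · simp only [A', if_pos hb]; exact hA b hb.1 hb.2
    · simp only [A', if_neg hb, norm_zero]; exact ha0
  have hplaq' : ∀ p : Plaq P j, (blockOf p.src = c.src ∨ blockOf p.src = c.tgt) →
      (blockOf (p.src.shift p.μ) = c.src ∨ blockOf (p.src.shift p.μ) = c.tgt) →
      (blockOf (p.src.shift p.ν) = c.src ∨ blockOf (p.src.shift p.ν) = c.tgt) →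
      (blockOf ((p.src.shift p.μ).shift p.ν) = c.src ∨ blockOf ((p.src.shift p.μ).shift p.ν) = c.tgt) →
      ‖((plaq U' p : (Matrix n n ℂ)ˣ) : Matrix n n ℂ) - 1‖ ≤ α := fun p c1 c2 c3 c4 => by
    have hpe : plaq U' p = plaq U p := by
      rw [plaq_eq, plaq_eq, hU'U ⟨p.src, p.μ⟩ c1 c2, hU'U ⟨p.src.shift p.μ, p.ν⟩ c2 c4, hU'U ⟨p.src, p.ν⟩ c1 c3,
        hU'U ⟨p.src.shift p.ν, p.μ⟩ c3 (by rw [PBond.tgt, Site.shift_comm]; exact c4)]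
    rw [hpe]; exact hplaq p c1 c2 c3 c4
  -- the axial gauge of the cut-off factor: globally `U1`, `= 1` at the centre, `= axialT U (emb c₋)` on the two blocks
  set v : Site P j → (Matrix n n ℂ)ˣ := axialT U' (emb c.src) with hvdef
  have hv1 : ∀ x, v x ∈ U1 (Matrix n n ℂ) := fun x => axialT_mem_U1 hU'1 _ x
  have hv0 : v (emb c.src) = 1 := axialT_self U' (emb c.src)
  have hvU : ∀ x : Site P j, (blockOf x = c.src ∨ blockOf x = c.tgt) → v x = axialT U (emb c.src) x := fun x hx =>
    axialT_congr_of_twoBlock hj hj2 c hU'U hx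
  -- cut off AFTER gauging: the near-identity factorised triple on ALL bonds
  let U₀ : GaugeField P j (Matrix n n ℂ)ˣ := fun b => if χ b then gaugeU v U' b else 1
  let S₀ : GaugeField P j (Matrix n n ℂ)ˣ := fun b => if χ b then gaugeU v Uc' b else 1
  let A₀ : PBond P j → Matrix n n ℂ := fun b => if χ b then adJ v A' b else 0
  have hS : ∀ b, S₀ b = expI η (A₀ b) * U₀ b := fun b => by
    by_cases hb : χ b
    · simp only [S₀, U₀, A₀, if_pos hb]; exact gaugeU_factors hf' v b
    · simp only [S₀, U₀, A₀, if_neg hb, expI_zero, one_mul]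
  have hA₀ : ∀ b, ‖A₀ b‖ ≤ a := fun b => by
    by_cases hb : χ b
    · simp only [A₀, if_pos hb]; exact norm_adJ_le_of_U1 hv1 hA' b
    · simp only [A₀, if_neg hb, norm_zero]; exact ha0
  have hU₀ : ∀ b, ‖((U₀ b : (Matrix n n ℂ)ˣ) : Matrix n n ℂ) - 1‖ ≤ t := fun b => by
    by_cases hb : χ b
    · simp only [U₀, if_pos hb]
      exact (norm_gaugeU_axialT_sub_one_le_of_twoBlock hj hj2 hU'1 c hα hplaq' b hb.1 hb.2).trans hRt
    · simp only [U₀, if_neg hb, Units.val_one, sub_self, norm_zero]; exact ht0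
  -- p623404's linearisation letter for the cut-off gauged triple
  have h9 := norm_potential_sub_linAvg_le hj hη hξ hS ha0 hA₀ hηa ht0 hU₀ hℓ c
  -- two-block locality of the averages and exact covariance, with `v(emb c₋) = 1`
  have hS₀loc : avgUnits S₀ c = avgUnits (gaugeU v Uc') c :=
    (emlAvgU_congr₂ hj c fun b h1 h2 => by simp only [S₀, χ, if_pos (And.intro h1 h2)]).symm
  have hU₀loc : avgUnits U₀ c = avgUnits (gaugeU v U') c :=
    (emlAvgU_congr₂ hj c fun b h1 h2 => by simp only [U₀, χ, if_pos (And.intro h1 h2)]).symm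
  have hquot : ((avgUnits S₀ c : (Matrix n n ℂ)ˣ) : Matrix n n ℂ) * (((avgUnits U₀ c)⁻¹ : (Matrix n n ℂ)ˣ) : Matrix n n ℂ) =
      ((avgUnits Uc c : (Matrix n n ℂ)ˣ) : Matrix n n ℂ) * (((avgUnits U c)⁻¹ : (Matrix n n ℂ)ˣ) : Matrix n n ℂ) := by
    have hUc'loc : avgUnits Uc' c = avgUnits Uc c := (emlAvgU_congr₂ hj c hUcUc').symm
    have hU'loc : avgUnits U' c = avgUnits U c := (emlAvgU_congr₂ hj c hUU').symm
    rw [hS₀loc, hU₀loc, ← Units.val_mul, avgUnits_mul_inv_gaugeU, hv0, one_mul, inv_one, mul_one, Units.val_mul, hUc'loc, hU'loc]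
  -- `Q₁A₀ = L·QA₀ − (λ̄₊ − λ̄₋)` and locality of `Q`, `λ̄`: `A₀ = Ad(v₀)A` on the two blocks
  set v₀ : Site P j → (Matrix n n ℂ)ˣ := axialT U (emb c.src) with hv₀
  have hQ : bondAvg A₀ c = bondAvg (adJ v₀ A) c := bondAvg_congr₂ hj c fun b h1 h2 => by
    simp only [A₀, A', χ, if_pos (And.intro h1 h2), adJ, hvU b.src h1]
  have hA₀A : ∀ (y : Site P (j + 1)), (y = c.src ∨ y = c.tgt) → combMean A₀ y = combMean (adJ v₀ A) y := fun y hy => by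
    refine combMean_congr_block hj y fun b h1 h2 => ?_
    have h1' : blockOf b.src = c.src ∨ blockOf b.src = c.tgt := by rcases hy with h | h <;> [exact Or.inl (h1.trans h); exact Or.inr (h1.trans h)]
    have h2' : blockOf b.tgt = c.src ∨ blockOf b.tgt = c.tgt := by rcases hy with h | h <;> [exact Or.inl (h2.trans h); exact Or.inr (h2.trans h)]
    simp only [A₀, A', χ, if_pos (And.intro h1' h2'), adJ, hvU b.src h1']
  rw [hquot, linAvg_eq_bondAvg_sub_grad_combMean, hQ, hA₀A c.tgt (Or.inr rfl), hA₀A c.src (Or.inl rfl)] at h9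
  -- the base change at `c₊` (file (2a) ★ + the `E`-conjugation of (2b)): `‖U_A m₊ U_A⁻¹ − λ̄₊‖ ≤ 69ℓ²ta`
  set ℓ : ℝ := (((P.d + 2) * P.L : ℕ) : ℝ) with hℓdef
  have hℓ0 : 0 ≤ ℓ := Nat.cast_nonneg _
  have hℓ1 : 1 ≤ ℓ := by
    rw [hℓdef]; have := P.L_pos; have : 1 ≤ (P.d + 2) * P.L := Nat.one_le_iff_ne_zero.mpr (by positivity); exact_mod_cast this
  have hℓt : 136 * ℓ * t ≤ 1 := by nlinarith [mul_nonneg hη ha0, mul_nonneg (mul_nonneg hη ha0) ht0]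
  have h2 := norm_combMean_sub_conj_combMean_le hj hj2 c ha0 hα (fun b h1 h2 => hA b (Or.inr h1) (Or.inr h2)) hU1 hplaq hRt
  set g : (Matrix n n ℂ)ˣ := v₀ (emb c.tgt) with hg
  set mt : Matrix n n ℂ := combMean (adJ (axialT U (emb c.tgt)) A) c.tgt with hmt
  set lt : Matrix n n ℂ := combMean (adJ v₀ A) c.tgt with hlt
  set ls : Matrix n n ℂ := combMean (adJ v₀ A) c.src with hls
  set UA : (Matrix n n ℂ)ˣ := avgUnits U c with hUA
  set X : Matrix n n ℂ := ((avgUnits Uc c : (Matrix n n ℂ)ˣ) : Matrix n n ℂ) * (((avgUnits U c)⁻¹ : (Matrix n n ℂ)ˣ) : Matrix n n ℂ) with hX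
  have hV₀ : ∀ b : PBond P j, (blockOf b.src = c.src ∨ blockOf b.src = c.tgt) → (blockOf b.tgt = c.src ∨ blockOf b.tgt = c.tgt) →
      ‖((gaugeU v U' b : (Matrix n n ℂ)ˣ) : Matrix n n ℂ) - 1‖ ≤ t := fun b h1 h2 =>
    (norm_gaugeU_axialT_sub_one_le_of_twoBlock hj hj2 hU'1 c hα hplaq' b h1 h2).trans hRt
  have h17 := (norm_emlAvgU_sub_one_sub_linAvg_le hj (S := gaugeU v U') c ht0 (by nlinarith) hV₀).2
  set E : (Matrix n n ℂ)ˣ := avgUnits (gaugeU v U') c with hE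
  change ‖(E : Matrix n n ℂ) - 1‖ ≤ 17 * ℓ * t at h17
  have hUA_eq : UA = E * g := by
    have hcov := avgUnits_gaugeU v U'
    have hloc : avgUnits U' c = avgUnits U c := emlAvgU_congr₂ hj c hU'U
    have hE' : E = v (emb c.src) * avgUnits U c * (v (emb c.tgt))⁻¹ := by
      rw [hE, hcov]; simp only [gaugeU, hloc]
    rw [hE', hv0, one_mul, hUA, hg, ← hvU _ (Or.inr (Site.blockOf_emb hj c.tgt)), inv_mul_cancel_right]
  have hmt' : ‖mt‖ ≤ ℓ * a := by
    let Yb : PBond P j → Matrix n n ℂ := fun b => if blockOf b.src = c.tgt ∧ blockOf b.tgt = c.tgt then adJ (axialT U (emb c.tgt)) A b else 0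
    have hY : ∀ b, ‖Yb b‖ ≤ a := fun b => by
      by_cases hb : blockOf b.src = c.tgt ∧ blockOf b.tgt = c.tgt
      · simp only [Yb, if_pos hb, adJ]
        have hu1 : axialT U (emb c.tgt) b.src ∈ U1 (Matrix n n ℂ) := by
          rw [axialT_congr_of_block hj (fun b' h1 h2 => (hU'U b' (Or.inr h1) (Or.inr h2)).symm) hb.1]; exact axialT_mem_U1 hU'1 _ _
        exact (norm_units_conj_le hu1 _).trans (hA b (Or.inr hb.1) (Or.inr hb.2))
      · simp only [Yb, if_neg hb, norm_zero]; exact ha0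
    have hmY : mt = combMean Yb c.tgt := combMean_congr_block hj c.tgt fun b h1 h2 => by simp only [Yb, if_pos (And.intro h1 h2)]
    rw [hmY]; exact norm_combMean_le_of_bound Yb ha0 hY c.tgt
  have hg1 : g ∈ U1 (Matrix n n ℂ) := by rw [hg, ← hvU _ (Or.inr (Site.blockOf_emb hj c.tgt))]; exact hv1 _
  have hY' : ‖(g : Matrix n n ℂ) * mt * ((g⁻¹ : (Matrix n n ℂ)ˣ) : Matrix n n ℂ)‖ ≤ ℓ * a := (norm_units_conj_le hg1 _).trans hmt'
  have hconjE : ‖(UA : Matrix n n ℂ) * mt * ((UA⁻¹ : (Matrix n n ℂ)ˣ) : Matrix n n ℂ) - (g : Matrix n n ℂ) * mt * ((g⁻¹ : (Matrix n n ℂ)ˣ) : Matrix n n ℂ)‖ ≤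
      4 * (17 * ℓ * t) * (ℓ * a) := by
    have hid : (UA : Matrix n n ℂ) * mt * ((UA⁻¹ : (Matrix n n ℂ)ˣ) : Matrix n n ℂ) =
        (E : Matrix n n ℂ) * ((g : Matrix n n ℂ) * mt * ((g⁻¹ : (Matrix n n ℂ)ˣ) : Matrix n n ℂ)) * ((E⁻¹ : (Matrix n n ℂ)ˣ) : Matrix n n ℂ) := by
      rw [hUA_eq, mul_inv_rev, Units.val_mul, Units.val_mul]; noncomm_ring
    rw [hid]
    exact (norm_conj_sub_le_of_near_one h17 (by nlinarith) _).trans (mul_le_mul_of_nonneg_left hY' (by positivity))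
  have hBC : ‖(UA : Matrix n n ℂ) * mt * ((UA⁻¹ : (Matrix n n ℂ)ˣ) : Matrix n n ℂ) - lt‖ ≤ 69 * ℓ ^ 2 * t * a := by
    have h2' : ‖lt - (g : Matrix n n ℂ) * mt * ((g⁻¹ : (Matrix n n ℂ)ˣ) : Matrix n n ℂ)‖ ≤ ℓ ^ 2 * t * a := h2
    have hsplit : (UA : Matrix n n ℂ) * mt * ((UA⁻¹ : (Matrix n n ℂ)ˣ) : Matrix n n ℂ) - lt =
        ((UA : Matrix n n ℂ) * mt * ((UA⁻¹ : (Matrix n n ℂ)ˣ) : Matrix n n ℂ) - (g : Matrix n n ℂ) * mt * ((g⁻¹ : (Matrix n n ℂ)ˣ) : Matrix n n ℂ)) -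
          (lt - (g : Matrix n n ℂ) * mt * ((g⁻¹ : (Matrix n n ℂ)ˣ) : Matrix n n ℂ)) := by abel
    rw [hsplit]
    refine (norm_sub_le _ _).trans ?_
    nlinarith [hconjE, h2', mul_nonneg (mul_nonneg hℓ0 ht0) ha0]
  -- assemble
  have hηξ : 0 ≤ η / ξ := div_nonneg hη hξ.le
  have hsplit : (I * (ξ : ℂ))⁻¹ • mlog X + ((η / ξ : ℝ) : ℂ) • ((UA : Matrix n n ℂ) * mt * ((UA⁻¹ : (Matrix n n ℂ)ˣ) : Matrix n n ℂ) - ls) -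
        ((η / ξ : ℝ) : ℂ) • (((P.L : ℕ) : ℂ) • bondAvg (adJ v₀ A) c) =
      ((I * (ξ : ℂ))⁻¹ • mlog X - ((η / ξ : ℝ) : ℂ) • (((P.L : ℕ) : ℂ) • bondAvg (adJ v₀ A) c - (lt - ls))) +
        ((η / ξ : ℝ) : ℂ) • ((UA : Matrix n n ℂ) * mt * ((UA⁻¹ : (Matrix n n ℂ)ˣ) : Matrix n n ℂ) - lt) := by
    simp only [smul_sub]; abel
  rw [hsplit]
  refine (norm_add_le _ _).trans (add_le_add h9 ?_)
  rw [norm_smul, Complex.norm_real, Real.norm_of_nonneg hηξ, hℓdef] 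
  rw [hℓdef] at hBC
  exact mul_le_mul_of_nonneg_left hBC hηξ

end Decomposition

end YMDAG.N18.TransportOfRecord

end
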